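import Summits.QuantumAdvantage.QuantumAdvantage.Theorems.LinnikCubicClassGroupsDegreeOnePrimesEscapeConjInvariantShortIntervalCongr
import Summits.QuantumAdvantage.QuantumAdvantage.Theorems.LinnikCubicClassGroupsDegreeOnePrimesEscapeSplittingTypePNTAll
import HarnessLib

/-!
# The splitting-type prime number theorem in SHORT INTERVALS in the Linnik range, for every number field

Topic `Summits/QuantumAdvantage/QuantumAdvantage/Theorems`, cell B2b-1 (linnik-cubic), PART A (gen 17); helper
toward the crux `DegreeOnePrimesEscape` (stmt-QuantumAdvantage-11543) of route `LinnikCubicClassGroups`.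
HONEST FRAMING: the value of this file is a THEOREM (kernel-checked, GRH-free, Siegel-free, unconditional) — NOT
summit progress.

**Theorem (`splittingType_shortInterval_dh`).**  For `n > 1` and `0 < κ ≤ 1` there are `δ, L, c > 0` such that
for every number field `K` of degree `n` with Galois-closure data `(N, f, ψ)` (`[N:ℚ] ≤ n!`,
`|d_N| ≤ |d_K|^{[N:ℚ]}`, `Gal(N/fK) = Stab_ψ(0)`; `exists_galoisClosure_perm`) there are `θ ∈ {0,1}`,
`β₁ ∈ (1 − c/(log|d_K| + log 4), 1)` and `K₁ ⊴ Gal(N/ℚ)` (Heilbronn–Stark) such that for every `σ`, with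
`T` the full cycle type of `ψ σ` and `S_T = {g : cycle type of ψ g = T}`, every `x ≥ |d_K|^L` and every `h` with
`x^{1−δ} ≤ h ≤ x`:
`|Σ_{x < p ≤ x+h, splittingType K p = T} log p − M_T| ≤ κ M_T`,
`M_T = (|S_T| h − θ (|S_T ∩ K₁| − |S_T ∖ K₁|) ((x+h)^{β₁} − x^{β₁})/β₁)/|Gal(N/ℚ)|` —
the short-interval (Hoheisel–Linnik) form of the gen-14 `splittingType_PNT`, with error RELATIVE to the main term
even in the flat regime (Deuring–Heilbronn), hence meaningful for every splitting type of every field.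
Proof: `conjInvariant_shortInterval_dh_congr` for the closure `N` and the conjugation-invariant set `S_T`, with the
predicate `splittingType K p = T`, which agrees with `Frob_p ∈ S_T` at `p ∤ d_N` (`frobenius_mem_cycleTypeSet_iff`);
constants made uniform over the degrees `m ≤ n!` of `N`.
References: [LagariasMontgomeryOdlyzko1979, Thm. 1.1]; [ThornerZaman2019, Thm. 3.2]; [Perlis1977, §1];
A. Balog, K. Ono, J. Number Theory 91 (2001); S. Gun, S. L. Naik, arXiv:2405.04698 (2024), Thm. 7.
-/

noncomputable section

open scoped NumberField nonZeroDivisors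
open Finset Real Ideal NumberField
open Literature.NumberTheory.NumberFields Literature.NumberTheory.LFunctions
  Literature.NumberTheory.LFunctions.NumberField

namespace Summit.QuantumAdvantage.QuantumAdvantage.Theorems.DegreeOnePrimesEscape

set_option maxHeartbeats 4000000 in
/-- **The splitting-type prime number theorem in short intervals in the Linnik range, for every number field**
(see the module docstring).  Unconditional. [cite: LagariasMontgomeryOdlyzko1979, Theorem 1.1]
[cite: ThornerZaman2019, Theorem 3.2] [cite: Perlis1977, §1] -/
theorem splittingType_shortInterval_dh (n : ℕ) [NeZero n] (hn : 1 < n) {κ : ℝ} (hκ : 0 < κ) (hκ1 : κ ≤ 1) :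
    ∃ δ L c : ℝ, 0 < δ ∧ δ ≤ 1 / 64 ∧ 0 < L ∧ 0 < c ∧ c ≤ 1 / 4 ∧ ∀ (K : Type) [Field K] [NumberField K],
      Module.finrank ℚ K = n →
      ∀ (N : Type) [Field N] [NumberField N] [IsGalois ℚ N] (f : K →ₐ[ℚ] N),
        Module.finrank ℚ N ≤ n.factorial →
        (NumberField.discr N).natAbs ≤ (NumberField.discr K).natAbs ^ Module.finrank ℚ N →
        ∀ ψ : (N ≃ₐ[ℚ] N) →* Equiv.Perm (Fin n),
          (∀ g : N ≃ₐ[ℚ] N, g ∈ f.fieldRange.fixingSubgroup ↔ ψ g 0 = 0) →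
          ∃ (θ β₁ : ℝ) (K₁ : Subgroup (N ≃ₐ[ℚ] N)), (θ = 0 ∨ θ = 1) ∧ K₁.Normal ∧
            1 - c / (Real.log ((NumberField.discr K).natAbs : ℝ) + Real.log 4) < β₁ ∧ β₁ < 1 ∧
            (θ = 1 → dedekindZeta₁ N β₁ = 0 ∧ K₁.index = 2 ∧
              ∀ H : Subgroup (N ≃ₐ[ℚ] N),
                dedekindZeta₁ (IntermediateField.fixedField H) β₁ = 0 ↔ H ≤ K₁) ∧
            (θ = 0 → K₁ = ⊤) ∧
            ∀ σ : N ≃ₐ[ℚ] N, ∀ x h : ℝ, ((NumberField.discr K).natAbs : ℝ) ^ L ≤ x →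
              x ^ (1 - δ) ≤ h → h ≤ x →
              |(∑ p ∈ (Nat.primesLE ⌊x + h⌋₊).filter (fun p : ℕ => splittingType K p =
                  (ψ σ).cycleType + Multiset.replicate (n - (ψ σ).support.card) 1), Real.log p) -
                (∑ p ∈ (Nat.primesLE ⌊x⌋₊).filter (fun p : ℕ => splittingType K p =
                  (ψ σ).cycleType + Multiset.replicate (n - (ψ σ).support.card) 1), Real.log p) -
                ((Nat.card {g : N ≃ₐ[ℚ] N //
                    (ψ g).cycleType + Multiset.replicate (n - (ψ g).support.card) 1 =
                      (ψ σ).cycleType + Multiset.replicate (n - (ψ σ).support.card) 1} : ℝ) * h -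
                  θ * ((Nat.card {g : N ≃ₐ[ℚ] N //
                      (ψ g).cycleType + Multiset.replicate (n - (ψ g).support.card) 1 =
                        (ψ σ).cycleType + Multiset.replicate (n - (ψ σ).support.card) 1 ∧ g ∈ K₁} : ℝ) -
                    Nat.card {g : N ≃ₐ[ℚ] N //
                      (ψ g).cycleType + Multiset.replicate (n - (ψ g).support.card) 1 =
                        (ψ σ).cycleType + Multiset.replicate (n - (ψ σ).support.card) 1 ∧ g ∉ K₁}) *
                    (((x + h) ^ β₁ - x ^ β₁) / β₁)) / Nat.card (N ≃ₐ[ℚ] N)| ≤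
                κ * (((Nat.card {g : N ≃ₐ[ℚ] N //
                    (ψ g).cycleType + Multiset.replicate (n - (ψ g).support.card) 1 =
                      (ψ σ).cycleType + Multiset.replicate (n - (ψ σ).support.card) 1} : ℝ) * h -
                  θ * ((Nat.card {g : N ≃ₐ[ℚ] N //
                      (ψ g).cycleType + Multiset.replicate (n - (ψ g).support.card) 1 =
                        (ψ σ).cycleType + Multiset.replicate (n - (ψ σ).support.card) 1 ∧ g ∈ K₁} : ℝ) -
                    Nat.card {g : N ≃ₐ[ℚ] N //
                      (ψ g).cycleType + Multiset.replicate (n - (ψ g).support.card) 1 =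
                        (ψ σ).cycleType + Multiset.replicate (n - (ψ σ).support.card) 1 ∧ g ∉ K₁}) *
                    (((x + h) ^ β₁ - x ^ β₁) / β₁)) / Nat.card (N ≃ₐ[ℚ] N)) := by
  classical
  -- one triple of constants for every possible degree `m ≤ n!` of `N`
  have hdeg : ∀ m : ℕ, ∃ δ L c : ℝ, 0 < δ ∧ δ ≤ 1 / 64 ∧ 0 < L ∧ 0 < c ∧ c ≤ 1 / 4 ∧ (1 < m →
      ∀ (N : Type) [Field N] [NumberField N] [IsGalois ℚ N], Module.finrank ℚ N = m →
      ∃ (θ β₁ : ℝ) (K₁ : Subgroup (N ≃ₐ[ℚ] N)), (θ = 0 ∨ θ = 1) ∧ K₁.Normal ∧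
        1 - c / (Real.log ((NumberField.discr N).natAbs : ℝ) + Real.log 4) < β₁ ∧ β₁ < 1 ∧
        (θ = 1 → dedekindZeta₁ N β₁ = 0 ∧ K₁.index = 2 ∧
          ∀ H : Subgroup (N ≃ₐ[ℚ] N),
            dedekindZeta₁ (IntermediateField.fixedField H) β₁ = 0 ↔ H ≤ K₁) ∧
        (θ = 0 → K₁ = ⊤ ∧ ¬ ∃ β : ℝ, dedekindZeta₁ N β = 0 ∧
          1 - c / (Real.log ((NumberField.discr N).natAbs : ℝ) + Real.log 4) < β ∧ β < 1) ∧
        ∀ S : Set (N ≃ₐ[ℚ] N), (∀ g g' : N ≃ₐ[ℚ] N, g ∈ S → g' * g * g'⁻¹ ∈ S) → S.Nonempty →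
          ∀ (P : ℕ → Prop) [DecidablePred P],
            (∀ p : ℕ, p.Prime → ¬ ((p : ℤ) ∣ NumberField.discr N) →
              (P p ↔ ∃ (Q : Ideal (𝓞 N)) (_ : Q.IsMaximal) (_ : Q.LiesOver (span {(p : ℤ)}))
                (φ : N ≃ₐ[ℚ] N), IsArithFrobAt ℤ φ Q ∧ Q.inertia (N ≃ₐ[ℚ] N) = ⊥ ∧ φ ∈ S)) →
          ∀ x h : ℝ, ((NumberField.discr N).natAbs : ℝ) ^ L ≤ x → x ^ (1 - δ) ≤ h → h ≤ x →
            |(∑ p ∈ (Nat.primesLE ⌊x + h⌋₊).filter P, Real.log p) -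
              (∑ p ∈ (Nat.primesLE ⌊x⌋₊).filter P, Real.log p) -
              ((Nat.card S : ℝ) * h -
                θ * ((Nat.card {g : N ≃ₐ[ℚ] N // g ∈ S ∧ g ∈ K₁} : ℝ) -
                  Nat.card {g : N ≃ₐ[ℚ] N // g ∈ S ∧ g ∉ K₁}) * (((x + h) ^ β₁ - x ^ β₁) / β₁)) /
                Nat.card (N ≃ₐ[ℚ] N)| ≤
              κ * (((Nat.card S : ℝ) * h -
                θ * ((Nat.card {g : N ≃ₐ[ℚ] N // g ∈ S ∧ g ∈ K₁} : ℝ) -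
                  Nat.card {g : N ≃ₐ[ℚ] N // g ∈ S ∧ g ∉ K₁}) * (((x + h) ^ β₁ - x ^ β₁) / β₁)) /
                Nat.card (N ≃ₐ[ℚ] N))) := by
    intro m
    by_cases hm : 1 < m
    · obtain ⟨δ, L, c, hδ, hδ64, hL, hc, hc4, -, h⟩ := conjInvariant_shortInterval_dh_congr m hm hκ hκ1
      exact ⟨δ, L, c, hδ, hδ64, hL, hc, hc4, fun _ => h⟩
    · exact ⟨1 / 64, 1, 1 / 4, by norm_num, le_rfl, one_pos, by norm_num, le_rfl, fun h => absurd h hm⟩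
  choose δf Lf cf hδf hδf64 hLf hcf hcf4 hthm using hdeg
  -- uniform constants: `δ = min_{m ≤ n!} δ_m`, `L = n! · Σ_{m ≤ n!} L_m`, `c = max_{m ≤ n!} c_m`
  set R : Finset ℕ := Finset.range (n.factorial + 1) with hR
  have hRne : R.Nonempty := ⟨0, by rw [hR]; simp⟩
  set δ : ℝ := R.inf' hRne δf with hδ
  set L : ℝ := (n.factorial : ℝ) * ∑ m ∈ R, Lf m with hL
  have hsum1 : ∀ m ≤ n.factorial, Lf m ≤ ∑ m ∈ R, Lf m := fun m hm =>
    Finset.single_le_sum (f := Lf) (fun i _ => (hLf i).le) (Finset.mem_range.mpr (Nat.lt_succ_of_le hm))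
  have hδle : ∀ m ≤ n.factorial, δ ≤ δf m := fun m hm =>
    Finset.inf'_le δf (Finset.mem_range.mpr (Nat.lt_succ_of_le hm))
  have hfac1 : (1 : ℝ) ≤ n.factorial := by exact_mod_cast Nat.succ_le_of_lt (Nat.factorial_pos n)
  have hLpos : 0 < L := by
    have : 0 < ∑ m ∈ R, Lf m := lt_of_lt_of_le (hLf 0) (hsum1 0 (Nat.zero_le _))
    rw [hL]; positivity
  have hδpos : 0 < δ := by
    rw [hδ, Finset.lt_inf'_iff]; exact fun m _ => hδf m
  have hδ64 : δ ≤ 1 / 64 := (hδle 0 (Nat.zero_le _)).trans (hδf64 0)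
  obtain ⟨m₀, -, hm₀⟩ := Finset.exists_max_image R cf hRne
  refine ⟨δ, L, cf m₀, hδpos, hδ64, hLpos, hcf m₀, hcf4 m₀,
    fun K _ _ hK N _ _ _ f hNle hdN ψ hstab => ?_⟩
  set m := Module.finrank ℚ N with hm
  have hKf : Module.finrank ℚ f.fieldRange = n := by
    rw [← hK]; exact (f.equivFieldRange.toLinearEquiv.finrank_eq).symm
  have hKN : n ≤ m := by
    rw [← hKf]
    have h2 := Module.finrank_mul_finrank ℚ f.fieldRange N
    have hpos : 0 < Module.finrank f.fieldRange N := Module.finrank_pos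
    exact le_of_le_of_eq (Nat.le_mul_of_pos_right _ hpos) h2
  have hm1 : 1 < m := lt_of_lt_of_le hn hKN
  have hcm : cf m ≤ cf m₀ := hm₀ m (Finset.mem_range.mpr (Nat.lt_succ_of_le hNle))
  obtain ⟨θ, β₁, K₁, hθ, hK₁n, hβ₁c, hβ₁1, h1, h0, hS⟩ := hthm m hm1 N rfl
  -- sizes
  set d : ℝ := ((NumberField.discr K).natAbs : ℝ) with hd
  set dN : ℝ := ((NumberField.discr N).natAbs : ℝ) with hdN'
  have hd3 : (3 : ℝ) ≤ d := three_le_natAbs_discr_real K (by rw [hK]; exact hn)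
  have hd1 : (1 : ℝ) ≤ d := by linarith
  have hdisc' : NumberField.discr f.fieldRange = NumberField.discr K :=
    (NumberField.discr_eq_discr_of_algEquiv K f.equivFieldRange).symm
  have hdKN : d ≤ dN := by
    have hdvd : NumberField.discr K ∣ NumberField.discr N := hdisc' ▸ NumberField.discr_dvd_discr f.fieldRange N
    rw [hd, hdN']
    exact_mod_cast Nat.le_of_dvd (Int.natAbs_pos.mpr (NumberField.discr_ne_zero N))
      (Int.natAbs_dvd_natAbs.mpr hdvd)
  have hℓK : 0 < Real.log d + Real.log 4 := by
    have := Real.log_pos (by linarith : (1 : ℝ) < d); have := Real.log_pos (by norm_num : (1 : ℝ) < 4)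
    linarith
  -- the window in terms of `d_K` and the uniform `c`
  have hwin : 1 - cf m₀ / (Real.log d + Real.log 4) ≤ 1 - cf m / (Real.log dN + Real.log 4) := by
    have hlog : Real.log d ≤ Real.log dN := Real.log_le_log (by linarith) hdKN
    have h2 : cf m / (Real.log dN + Real.log 4) ≤ cf m₀ / (Real.log d + Real.log 4) :=
      div_le_div₀ (hcf m₀).le hcm hℓK (by linarith)
    linarith
  -- the range in terms of `d_K` and the uniform `L`, `δ`
  have hxN : ∀ x : ℝ, d ^ L ≤ x → dN ^ Lf m ≤ x := by
    intro x hx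
    have hdNR : dN ≤ d ^ (m : ℝ) := by
      rw [Real.rpow_natCast, hd, hdN']; exact_mod_cast hdN
    have h3 : (m : ℝ) * Lf m ≤ L := by
      rw [hL]
      have hmf : (m : ℝ) ≤ n.factorial := by exact_mod_cast hNle
      exact mul_le_mul hmf (hsum1 m hNle) (hLf m).le (by positivity)
    calc dN ^ Lf m ≤ (d ^ (m : ℝ)) ^ Lf m :=
          Real.rpow_le_rpow (by rw [hdN']; positivity) hdNR (hLf m).le
      _ = d ^ ((m : ℝ) * Lf m) := by rw [← Real.rpow_mul (by linarith)]
      _ ≤ d ^ L := Real.rpow_le_rpow_of_exponent_le hd1 h3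
      _ ≤ x := hx
  have hhN : ∀ x h : ℝ, d ^ L ≤ x → x ^ (1 - δ) ≤ h → x ^ (1 - δf m) ≤ h := by
    intro x h hx hhx
    have hx1 : (1 : ℝ) ≤ x := (Real.one_le_rpow hd1 hLpos.le).trans hx
    have := hδle m hNle
    exact (Real.rpow_le_rpow_of_exponent_le hx1 (by linarith)).trans hhx
  refine ⟨θ, β₁, K₁, hθ, hK₁n, lt_of_le_of_lt hwin hβ₁c, hβ₁1, h1, fun h00 => (h0 h00).1,
    fun σ x h hx hhx hhx' => ?_⟩
  -- the conjugation-invariant set `S_T` and the dictionary at `p ∤ d_N`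
  set T : Multiset ℕ := (ψ σ).cycleType + Multiset.replicate (n - (ψ σ).support.card) 1 with hT
  have hSinv := conjInvariant_cycleTypeSet ψ T
  have hSne : ({g : N ≃ₐ[ℚ] N |
      (ψ g).cycleType + Multiset.replicate (n - (ψ g).support.card) 1 = T} : Set (N ≃ₐ[ℚ] N)).Nonempty :=
    ⟨σ, by rw [Set.mem_setOf_eq, hT]⟩
  have hP : ∀ p : ℕ, p.Prime → ¬ ((p : ℤ) ∣ NumberField.discr N) →
      (splittingType K p = T ↔ ∃ (Q : Ideal (𝓞 N)) (_ : Q.IsMaximal) (_ : Q.LiesOver (span {(p : ℤ)}))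
        (φ : N ≃ₐ[ℚ] N), IsArithFrobAt ℤ φ Q ∧ Q.inertia (N ≃ₐ[ℚ] N) = ⊥ ∧
          φ ∈ {g : N ≃ₐ[ℚ] N |
            (ψ g).cycleType + Multiset.replicate (n - (ψ g).support.card) 1 = T}) := by
    intro p hp hpN
    rw [ArithmeticallyEquivalent.of_algEquiv f.equivFieldRange p hp]
    exact (frobenius_mem_cycleTypeSet_iff f.fieldRange ψ hstab hKf T hp hpN).symm
  exact hS _ hSinv hSne (fun p : ℕ => splittingType K p = T) hP x h (hxN x hx) (hhN x h hx hhx) hhx'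

end Summit.QuantumAdvantage.QuantumAdvantage.Theorems.DegreeOnePrimesEscape

end
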